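import Literature.AlgebraicTopology.Homotopy.CubicalSets
import Literature.AlgebraicTopology.Homotopy.WhiteheadCWContractible
import HarnessLib

/-!
# Cells of the unit cubical grid of `ℝᴺ`: the face relation, finiteness, and filling a cell

Topic `Literature/AlgebraicTopology/Homotopy`; a layer over `CubicalSets.lean` (namespace
`Literature.AlgebraicTopology.Homotopy.Cubical`: `closedFace`, `openFace`, `nonInt`, `faceMap`,
`faceInv`), written for the grid extension of `GridExtension.lean` and the theorem that weakly
contractible manifolds are contractible (`WeaklyContractibleManifold.lean`):

* `Cubical.Cell N = Finset (Fin N) × (Fin N → ℤ)`: a cell of the unit grid, given by its free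
  coordinates `S` and its integer corner `m`; `Cell.ccl c = closedFace c.1 c.2`,
  `Cell.opn c = openFace c.1 c.2`, `Cell.dim c = |S|`, the cell `Cell.cellOf y = (nonInt y, ⌊y⌋)`
  through a point (`mem_opn_cellOf`, `cellOf_eq_of_mem_opn` are `CubicalSets`'
  `mem_openFace_nonInt_floor`, `eq_of_mem_openFace`), and the unit cubes `Cell.cube m`.
* `Cubical.Cell.IsFace c' c`: the (combinatorial) face relation — `S' ⊆ S`, equal corners on the
  coordinates free in `c'` or frozen in `c`, corner `mᵢ` or `mᵢ + 1` on the coordinates free in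
  `c` and frozen in `c'`; it is reflexive and transitive, implies `ccl c' ⊆ ccl c`, characterises
  membership in a closed cell (`mem_ccl_iff_isFace : y ∈ ccl c ↔ IsFace (cellOf y) c`), does not
  increase dimension, and each cell has finitely many faces (`finite_setOf_isFace`).
* metric facts: two points of one closed cell are at sup distance `≤ 1`, every point lies in a
  closed unit cube, only finitely many unit cubes meet a bounded set.
* `Cubical.Cell.exists_cell_extension`: **filling the box over a cell** — the box-filling lemma
  `Literature.AlgebraicTopology.Homotopy.WhiteheadCW.exists_box_extension` (Hatcher, *Algebraic
  Topology* (2002), proof of Lemma 4.7 with the retraction of Prop. 0.16) transported along the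
  affine chart `faceMap`/`faceInv` of the cell: GIVEN that cubes in `X` contract to `x₀`
  (`WhiteheadCW.CubesContract x₀`), bottom values on `ccl c × {0}` and side values on
  `(ccl c ∖ opn c) × [0, 1]` constant `= x₀` from time `τ` on extend continuously over
  `ccl c × [0, 1]`, constant `= x₀` from time `τ' > τ` on.

Everything is proved (`[folklore]`); no named facts.

## References

* A. Hatcher, *Algebraic Topology*, CUP (2002), §4.1, Lemma 4.7 and Prop. 0.16. [HatcherAT2002]
-/

noncomputable section

open Set Metric

namespace Literature.AlgebraicTopology.Homotopy

namespace Cubical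

variable {N : ℕ}

/-- A **cell of the unit cubical grid** of `ℝᴺ`: its set of free coordinates and its integer
corner. [folklore] -/
abbrev Cell (N : ℕ) : Type := Finset (Fin N) × (Fin N → ℤ)

namespace Cell

/-- The closed cell. [folklore] -/
def ccl (c : Cell N) : Set (Fin N → ℝ) := closedFace c.1 c.2

/-- The relatively open cell. [folklore] -/
def opn (c : Cell N) : Set (Fin N → ℝ) := openFace c.1 c.2

/-- The dimension of a cell: the number of free coordinates. [folklore] -/
def dim (c : Cell N) : ℕ := c.1.card

/-- The cell through a point (the unique cell whose open part contains it): free coordinates the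
non-integral ones, corner the integer part. [folklore] -/
def cellOf (y : Fin N → ℝ) : Cell N := (nonInt y, fun i => ⌊y i⌋)

/-- The top-dimensional cell (unit cube) with corner `m`. [folklore] -/
def top (m : Fin N → ℤ) : Cell N := (Finset.univ, m)

/-- The closed unit cube `[m, m + 1]`. [folklore] -/
abbrev cube (m : Fin N → ℤ) : Set (Fin N → ℝ) := ccl (top m)

/-- Unfolding `ccl`. [folklore] -/
theorem ccl_def (c : Cell N) : ccl c = closedFace c.1 c.2 := rfl

/-- Unfolding `opn`. [folklore] -/
theorem opn_def (c : Cell N) : opn c = openFace c.1 c.2 := rfl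

/-- The open cell lies in the closed cell. [folklore] -/
theorem opn_subset_ccl (c : Cell N) : opn c ⊆ ccl c := openFace_subset_closedFace _ _

/-- Closed cells are closed. [folklore] -/
theorem isClosed_ccl (c : Cell N) : IsClosed (ccl c) := isClosed_closedFace _ _

/-- A closed cell lies in the box `[m, m + 1]`. [folklore] -/
theorem ccl_subset_Icc (c : Cell N) :
    ccl c ⊆ Icc (fun i => (c.2 i : ℝ)) (fun i => (c.2 i : ℝ) + 1) := by
  intro y hy
  refine ⟨fun i => ?_, fun i => ?_⟩
  · by_cases hi : i ∈ c.1
    · exact (hy.1 i hi).1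
    · exact (hy.2 i hi).ge
  · by_cases hi : i ∈ c.1
    · exact (hy.1 i hi).2
    · rw [hy.2 i hi]; linarith

/-- Closed cells are compact. [folklore] -/
theorem isCompact_ccl (c : Cell N) : IsCompact (ccl c) :=
  isCompact_Icc.of_isClosed_subset (isClosed_ccl c) (ccl_subset_Icc c)

/-- Every point lies in the open part of its cell. [folklore] -/
theorem mem_opn_cellOf (y : Fin N → ℝ) : y ∈ opn (cellOf y) := mem_openFace_nonInt_floor y

/-- Every point lies in the closed cell of its cell. [folklore] -/
theorem mem_ccl_cellOf (y : Fin N → ℝ) : y ∈ ccl (cellOf y) :=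
  opn_subset_ccl _ (mem_opn_cellOf y)

/-- The cell whose open part contains `y` is `cellOf y`. [folklore] -/
theorem cellOf_eq_of_mem_opn {c : Cell N} {y : Fin N → ℝ} (hy : y ∈ opn c) : cellOf y = c := by
  obtain ⟨h1, h2⟩ := eq_of_mem_openFace hy
  exact Prod.ext h1.symm h2.symm

/-- The dimension of the cell through `y` is its number of non-integral coordinates.
[folklore] -/
theorem dim_cellOf (y : Fin N → ℝ) : dim (cellOf y) = (nonInt y).card := rfl

/-- The dimension of a cell is at most `N`. [folklore] -/
theorem dim_le (c : Cell N) : dim c ≤ N := by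
  simpa only [dim, Finset.card_univ, Fintype.card_fin] using c.1.card_le_univ

/-- A point of a closed cell off its open part lies in a cell of smaller dimension.
[folklore] -/
theorem dim_cellOf_lt {c : Cell N} {y : Fin N → ℝ} (hy : y ∈ ccl c) (hy' : y ∉ opn c) :
    dim (cellOf y) < dim c :=
  card_nonInt_lt_of_mem_closedFace_diff hy hy'

/-! ### The face relation -/

/-- The **face relation**: `c'` is a face of `c` iff the free coordinates of `c'` are free in
`c`, the corners agree on the coordinates free in `c'` or frozen in `c`, and on a coordinate free
in `c` but frozen in `c'` the corner of `c'` is `mᵢ` or `mᵢ + 1`. [folklore] -/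
def IsFace (c' c : Cell N) : Prop :=
  c'.1 ⊆ c.1 ∧ ∀ i, (i ∉ c.1 ∨ i ∈ c'.1 → c'.2 i = c.2 i) ∧
    (i ∈ c.1 → i ∉ c'.1 → c'.2 i = c.2 i ∨ c'.2 i = c.2 i + 1)

/-- The face relation is reflexive. [folklore] -/
theorem IsFace.refl (c : Cell N) : IsFace c c :=
  ⟨Finset.Subset.refl _, fun _ => ⟨fun _ => rfl, fun hi hi' => absurd hi hi'⟩⟩

/-- The face relation is transitive. [folklore] -/
theorem IsFace.trans {c₁ c₂ c₃ : Cell N} (h₁ : IsFace c₁ c₂) (h₂ : IsFace c₂ c₃) : IsFace c₁ c₃ := by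
  refine ⟨h₁.1.trans h₂.1, fun i => ⟨fun hi => ?_, fun hi hi' => ?_⟩⟩
  · rcases hi with hi | hi
    · have h2i : i ∉ c₂.1 := fun h => hi (h₂.1 h)
      rw [(h₁.2 i).1 (Or.inl h2i), (h₂.2 i).1 (Or.inl hi)]
    · rw [(h₁.2 i).1 (Or.inr hi), (h₂.2 i).1 (Or.inr (h₁.1 hi))]
  · by_cases h2i : i ∈ c₂.1
    · rw [← (h₂.2 i).1 (Or.inr h2i)]
      exact (h₁.2 i).2 h2i hi'
    · rw [(h₁.2 i).1 (Or.inl h2i)]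
      exact (h₂.2 i).2 hi h2i

/-- The closed cell of a face lies in the closed cell. [folklore] -/
theorem IsFace.ccl_subset {c' c : Cell N} (h : IsFace c' c) : ccl c' ⊆ ccl c := by
  intro y hy
  refine ⟨fun i hi => ?_, fun i hi => ?_⟩
  · by_cases hi' : i ∈ c'.1
    · have hm : (c'.2 i : ℝ) = c.2 i := by exact_mod_cast (h.2 i).1 (Or.inr hi')
      have h1 := hy.1 i hi'
      rw [hm] at h1
      exact h1
    · have h1 : y i = c'.2 i := hy.2 i hi'
      rcases (h.2 i).2 hi hi' with hm | hm
      · rw [h1, hm]; simp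
      · rw [h1, hm]; push_cast; constructor <;> linarith
  · have hi' : i ∉ c'.1 := fun h' => hi (h.1 h')
    rw [hy.2 i hi']
    exact_mod_cast (h.2 i).1 (Or.inl hi)

/-- The cell through a point of a closed cell is a face of it. [folklore] -/
theorem isFace_cellOf_of_mem_ccl {c : Cell N} {y : Fin N → ℝ} (hy : y ∈ ccl c) :
    IsFace (cellOf y) c := by
  refine ⟨nonInt_subset_of_mem_closedFace hy, fun i => ⟨fun hi => ?_, fun hi hi' => ?_⟩⟩
  · show ⌊y i⌋ = c.2 i
    rcases hi with hi | hi
    · rw [hy.2 i hi, Int.floor_intCast]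
    · have hni : ¬ IsInt (y i) := mem_nonInt.1 hi
      have hiS : i ∈ c.1 := nonInt_subset_of_mem_closedFace hy hi
      have h1 := hy.1 i hiS
      refine Int.floor_eq_iff.2 ⟨h1.1, lt_of_le_of_ne h1.2 fun h => hni ?_⟩
      rw [h]; exact ⟨c.2 i + 1, by push_cast; ring⟩
  · show ⌊y i⌋ = c.2 i ∨ ⌊y i⌋ = c.2 i + 1
    have hint : IsInt (y i) := by
      by_contra h; exact hi' (mem_nonInt.2 h)
    obtain ⟨z, hz⟩ := hint
    have h1 := hy.1 i hi
    rw [← hz, Int.floor_intCast]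
    rw [← hz] at h1
    have h3 : c.2 i ≤ z := by exact_mod_cast h1.1
    have h4 : z ≤ c.2 i + 1 := by exact_mod_cast h1.2
    omega

/-- A point lies in a closed cell iff its own cell is a face of it. [folklore] -/
theorem mem_ccl_iff_isFace {c : Cell N} {y : Fin N → ℝ} : y ∈ ccl c ↔ IsFace (cellOf y) c :=
  ⟨isFace_cellOf_of_mem_ccl, fun h => h.ccl_subset (mem_ccl_cellOf y)⟩

/-- Faces do not increase dimension. [folklore] -/
theorem IsFace.dim_le {c' c : Cell N} (h : IsFace c' c) : dim c' ≤ dim c :=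
  Finset.card_le_card h.1

/-- The faces of a cell form a finite set. [folklore] -/
theorem finite_setOf_isFace (c : Cell N) : {c' : Cell N | IsFace c' c}.Finite := by
  have hsub : {c' : Cell N | IsFace c' c} ⊆
      (↑c.1.powerset : Set (Finset (Fin N))) ×ˢ Set.pi univ fun i => {c.2 i, c.2 i + 1} := by
    rintro ⟨S', m'⟩ h
    refine ⟨Finset.mem_coe.2 (Finset.mem_powerset.2 h.1), fun i _ => ?_⟩
    show m' i ∈ ({c.2 i, c.2 i + 1} : Set ℤ)
    by_cases hi : i ∈ c.1
    · by_cases hi' : i ∈ S'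
      · exact Or.inl ((h.2 i).1 (Or.inr hi'))
      · exact (h.2 i).2 hi hi'
    · exact Or.inl ((h.2 i).1 (Or.inl hi))
  exact ((c.1.powerset.finite_toSet).prod (Set.Finite.pi fun i => by simp)).subset hsub

/-! ### Metric facts -/

/-- Two points of one closed cell are at (sup) distance at most `1`. [folklore] -/
theorem dist_le_one_of_mem_ccl {c : Cell N} {y y' : Fin N → ℝ} (hy : y ∈ ccl c)
    (hy' : y' ∈ ccl c) : dist y y' ≤ 1 := by
  refine (dist_pi_le_iff zero_le_one).2 fun i => ?_
  have h1 := ccl_subset_Icc c hy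
  have h2 := ccl_subset_Icc c hy'
  rw [Real.dist_eq, abs_le]
  constructor <;> linarith [h1.1 i, h1.2 i, h2.1 i, h2.2 i]

/-- Every point lies in the closed unit cube with corner its integer part. [folklore] -/
theorem mem_cube_floor (y : Fin N → ℝ) : y ∈ cube fun i => ⌊y i⌋ :=
  ⟨fun i _ => ⟨Int.floor_le (y i), (Int.lt_floor_add_one (y i)).le⟩,
    fun i hi => absurd (Finset.mem_univ i) hi⟩

/-- Only finitely many closed unit cubes meet a bounded set. [folklore] -/
theorem finite_setOf_cube_inter_nonempty {T : Set (Fin N → ℝ)} (hT : Bornology.IsBounded T) :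
    {m : Fin N → ℤ | (cube m ∩ T).Nonempty}.Finite := by
  obtain ⟨ρ, hρ⟩ := hT.subset_closedBall 0
  have hsub : {m : Fin N → ℤ | (cube m ∩ T).Nonempty} ⊆
      Set.pi univ fun _ => Icc (⌊-ρ⌋ - 1) ⌈ρ⌉ := by
    rintro m ⟨y, hym, hyT⟩ i -
    have hyi : |y i| ≤ ρ := by
      have h1 : ‖y i‖ ≤ ‖y‖ := norm_le_pi_norm y i
      have h2 : ‖y‖ ≤ ρ := mem_closedBall_zero_iff.1 (hρ hyT)
      rw [Real.norm_eq_abs] at h1; linarith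
    rw [abs_le] at hyi
    have hc := ccl_subset_Icc _ hym
    have hc1 : (m i : ℝ) ≤ y i := hc.1 i
    have hc2 : y i ≤ (m i : ℝ) + 1 := hc.2 i
    constructor
    · have h5 : ⌊-ρ⌋ ≤ m i + 1 := by
        have := Int.floor_le (-ρ)
        exact_mod_cast (show (⌊-ρ⌋ : ℝ) ≤ (m i : ℝ) + 1 by linarith)
      linarith
    · exact Int.cast_le.1 ((show (m i : ℝ) ≤ ρ by linarith).trans (Int.le_ceil _))
  exact (Set.Finite.pi fun _ => Set.finite_Icc _ _).subset hsub

/-! ### Filling a cell: `exists_box_extension` transported along the affine chart -/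

/-- The enumeration of the free coordinates of a cell used for its chart. [folklore] -/
def enumFree (c : Cell N) : Fin (dim c) ≃ ↥c.1 := enum c.1 rfl

/-- The affine chart `[-1, 1]^{dim c} → ccl c` of a cell (`Cubical.faceMap`). [folklore] -/
def chart (c : Cell N) : (Fin (dim c) → ℝ) → (Fin N → ℝ) := faceMap c.1 c.2 (enumFree c)

/-- The inverse chart `ccl c → [-1, 1]^{dim c}` of a cell (`Cubical.faceInv`). [folklore] -/
def unchart (c : Cell N) : (Fin N → ℝ) → (Fin (dim c) → ℝ) := faceInv c.1 c.2 (enumFree c)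

variable {X : Type*} [TopologicalSpace X]

/-- **Filling the box over a cell of the unit grid**, GIVEN that cubes in `X` contract to `x₀`
(`WhiteheadCW.CubesContract x₀`: `π_m(X, x₀) = 0` in the cubical model, all `m`): prescribed
values `φ` on the bottom `ccl c × {0}` and `F` on the sides `(ccl c ∖ opn c) × [0, 1]`, the
latter constant `= x₀` from time `τ` on, extend continuously to the solid box `ccl c × [0, 1]`,
with value `x₀` from time `τ' > τ` on. This is `WhiteheadCW.exists_box_extension` (Hatcher 2002,
Lemma 4.7, proof) transported along the affine chart of the cell. [folklore] -/
theorem exists_cell_extension (x₀ : X) (hX : WhiteheadCW.CubesContract x₀)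
    {τ τ' : ℝ} (hτ : 0 < τ) (hττ' : τ < τ') (hτ'1 : τ' ≤ 1) (c : Cell N)
    {φ : (Fin N → ℝ) → X} (hφ : ContinuousOn φ (ccl c))
    {F : (Fin N → ℝ) × ℝ → X} (hF : ContinuousOn F ((ccl c \ opn c) ×ˢ Icc (0 : ℝ) 1))
    (h0 : ∀ y ∈ ccl c \ opn c, F (y, 0) = φ y)
    (hlate : ∀ y ∈ ccl c \ opn c, ∀ t ∈ Icc τ 1, F (y, t) = x₀) :
    ∃ G : (Fin N → ℝ) × ℝ → X, ContinuousOn G (ccl c ×ˢ Icc (0 : ℝ) 1) ∧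
      (∀ y ∈ ccl c, G (y, 0) = φ y) ∧
      (∀ y ∈ ccl c \ opn c, ∀ t ∈ Icc (0 : ℝ) 1, G (y, t) = F (y, t)) ∧
      (∀ y ∈ ccl c, ∀ t ∈ Icc τ' 1, G (y, t) = x₀) := by
  have hsph : ∀ w ∈ sphere (0 : Fin (dim c) → ℝ) 1, chart c w ∈ ccl c \ opn c := fun w hw =>
    ⟨faceMap_mem_closedFace _ _ _ (sphere_subset_closedBall hw), faceMap_not_mem_openFace _ _ _ hw⟩
  have hg : Continuous fun p : (Fin (dim c) → ℝ) × ℝ => (chart c p.1, p.2) := by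
    unfold chart; fun_prop
  obtain ⟨G, hGc, hG0, hGs, hGl⟩ := WhiteheadCW.exists_box_extension x₀ hτ hττ' hτ'1 (hX (dim c))
    (φ := φ ∘ chart c)
    (hφ.comp (continuous_faceMap _ _ _).continuousOn fun w hw => faceMap_mem_closedFace _ _ _ hw)
    (h := fun p => F (chart c p.1, p.2))
    (hF.comp hg.continuousOn fun p hp => ⟨hsph _ hp.1, hp.2⟩)
    (fun w hw => h0 _ (hsph w hw)) (fun w hw t ht => hlate _ (hsph w hw) t ht)
  have hg' : Continuous fun p : (Fin N → ℝ) × ℝ => (unchart c p.1, p.2) := by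
    unfold unchart; fun_prop
  refine ⟨fun p => G (unchart c p.1, p.2), ?_, ?_, ?_, ?_⟩
  · exact hGc.comp hg'.continuousOn fun p hp => ⟨faceInv_mem_closedBall _ _ _ hp.1, hp.2⟩
  · intro y hy
    show G (unchart c y, 0) = φ y
    rw [hG0 (unchart c y) (faceInv_mem_closedBall c.1 c.2 (enumFree c) hy), Function.comp_apply]
    show φ (faceMap c.1 c.2 (enumFree c) (faceInv c.1 c.2 (enumFree c) y)) = φ y
    rw [faceMap_faceInv _ _ _ hy]
  · intro y hy t ht
    show G (unchart c y, t) = F (y, t)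
    rw [hGs (unchart c y) (faceInv_mem_sphere c.1 c.2 (enumFree c) hy.1 hy.2) t ht]
    show F (faceMap c.1 c.2 (enumFree c) (faceInv c.1 c.2 (enumFree c) y), t) = F (y, t)
    rw [faceMap_faceInv _ _ _ hy.1]
  · intro y hy t ht
    exact hGl _ (faceInv_mem_closedBall _ _ _ hy) t ht

end Cell

end Cubical

end Literature.AlgebraicTopology.Homotopy

end
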